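import Summits.CriticalPhenomena.PercolationContinuityZ3.Theorems.PercNearOneGluingNoHeavyLowerTailSahiOneStepSubblockThreshold
import Summits.CriticalPhenomena.PercolationContinuityZ3.Theorems.PercNearOneGluingNoHeavyLowerTailSahiOneStepThresholdStep
import Summits.CriticalPhenomena.PercolationContinuityZ3.Theorems.PercNearOneGluingNoHeavyLowerTailSahiOneStepFreeExtension
import HarnessLib

/-!
# One-step scheme: `(2′)` for the threshold of an ARBITRARY block, and Kahn C5 / Sahi `C₃` for two arbitrary block thresholds

Prover prim-ineq-prove-3 gen 20 (`--supports stmt-CriticalPhenomena-4575`; memo `run/shared/lean/prim/prim-ineq-prove-3/FINDING-G20-COUPLING-SPLIT.md` §2).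
No definitions, no named facts, no sorries.

`…SubblockThreshold.osN_subblockThreshold_nonneg` needs `T ⊆ F`.  Here the block `T` of the second threshold is ARBITRARY: the coordinates of `T ∖ F`
are free for the first slot `H = {N_F ≥ t}`, and gen 15's free-coordinate splitting `osN_ind_ind_free_split` (a sum of four `n`'s of section pairs plus a
nonnegative term) peels them one at a time; the sections of `{N_T ≥ r}` along `e ∈ T ∖ F` are the thresholds `{N_{T∖e} ≥ r−1}` and `{N_{T∖e} ≥ r}`
(`section_insert_threshold`, `section_sdiff_threshold`), so the induction on `|T ∖ F|` closes on the nested case.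

* `osN_threshold_blockThreshold_nonneg` — `0 ≤ osN p {N_F ≥ t} 1_U 1_{N_T ≥ r}` for ALL finsets `F, T`, all `t, r`, every increasing `U`;
* `sahiE3_threshold_blockThreshold_nonneg` — **`0 ≤ E₃(1_{N_F ≥ t}, 1_U, 1_{N_T ≥ r})` for all `F, T, t, r` and every increasing `U`**: Sahi/Kahn
  positivity for every triple {two block thresholds, one arbitrary increasing event}.
-/

noncomputable section

namespace Summit.CriticalPhenomena.PercolationContinuityZ3.Theorems

namespace SahiOneStep

open MeasureTheory Finset
open Literature.Probability.Percolation (DeterminedBy determinedBy_iff)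
open Literature.Probability.LatticeModels (prodBernoulli sahiE3)
open Literature.Probability.Percolation.DecisionTree (ind)
open scoped Classical

variable {ι : Type*} [Fintype ι]

omit [Fintype ι] in
/-- The threshold event of a block is increasing. [folklore] -/
theorem isUpperSet_threshold (T : Finset ι) (r : ℕ) : IsUpperSet {ω : Set ι | r ≤ (T.filter (· ∈ ω)).card} := by
  intro ω ω' hle hω
  simp only [Set.mem_setOf_eq] at hω ⊢
  refine hω.trans (Finset.card_le_card fun i hi => ?_)
  rw [Finset.mem_filter] at hi ⊢
  exact ⟨hi.1, hle hi.2⟩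

omit [Fintype ι] in
/-- The threshold-`0` event is everything. [folklore] -/
theorem threshold_zero_eq (T T' : Finset ι) :
    {ω : Set ι | 0 ≤ (T.filter (· ∈ ω)).card} = {ω : Set ι | 0 ≤ (T'.filter (· ∈ ω)).card} := by
  ext ω; simp

/-- **`(2′)` for the threshold of an arbitrary block.**  For all finsets `F, T`, all `t r : ℕ` and every increasing `U`:
`0 ≤ osN p {N_F ≥ t} 1_U 1_{N_T ≥ r}`.  Induction on `|T ∖ F|` by free-coordinate peeling from the nested case `T ⊆ F`. [this work] -/
theorem osN_threshold_blockThreshold_nonneg (p : ι → unitInterval) (F : Finset ι) (t : ℕ) :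
    ∀ (n : ℕ) (T : Finset ι) (r : ℕ) {U : Set (Set ι)}, (T \ F).card = n → IsUpperSet U →
      0 ≤ osN p {ω : Set ι | t ≤ (F.filter (· ∈ ω)).card} (ind U) (ind {ω : Set ι | r ≤ (T.filter (· ∈ ω)).card}) := by
  intro n
  induction n with
  | zero =>
    intro T r U hT hU
    have hTF : T ⊆ F := by
      rw [Finset.card_eq_zero, Finset.sdiff_eq_empty_iff_subset] at hT; exact hT
    exact osN_subblockThreshold_nonneg p F hTF t r hU
  | succ n ih =>
    intro T r U hT hU
    -- a free coordinate `e ∈ T ∖ F`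
    obtain ⟨e, he⟩ : (T \ F).Nonempty := by
      rw [← Finset.card_pos, hT]; exact Nat.succ_pos n
    have heT : e ∈ T := (Finset.mem_sdiff.1 he).1
    have heF : e ∉ F := (Finset.mem_sdiff.1 he).2
    set T' : Finset ι := T.erase e with hT'
    have heT' : e ∉ T' := Finset.notMem_erase e T
    have hTins : T = insert e T' := by rw [hT', Finset.insert_erase heT]
    have hcard : (T' \ F).card = n := by
      have h1 : T' \ F = (T \ F).erase e := by
        ext i
        simp only [hT', Finset.mem_sdiff, Finset.mem_erase]
        tauto
      rw [h1, Finset.card_erase_of_mem he, hT]; omega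
    -- `H` does not depend on `e`
    have hH : DeterminedBy {ω : Set ι | t ≤ (F.filter (· ∈ ω)).card} ((({e} : Finset ι) : Set ι)ᶜ) :=
      (determinedBy_threshold F t).mono fun i hi => by
        simp only [Finset.coe_singleton, Set.mem_compl_iff, Set.mem_singleton_iff]
        exact fun hie => heF (hie ▸ Finset.mem_coe.1 hi)
    cases r with
    | zero =>
      -- threshold `0` is everything: replace `T` by `∅ ⊆ F`
      rw [threshold_zero_eq T ∅]
      exact osN_subblockThreshold_nonneg p F (Finset.empty_subset F) t 0 hU
    | succ r =>
      have hB : IsUpperSet {ω : Set ι | r + 1 ≤ (T.filter (· ∈ ω)).card} := isUpperSet_threshold T (r + 1)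
      rw [osN_ind_ind_free_split p e hH hU hB]
      -- the sections of the threshold of `T = insert e T'`
      have s1 : {ω : Set ι | insert e ω ∈ {ω : Set ι | r + 1 ≤ (T.filter (· ∈ ω)).card}} =
          {ω : Set ι | r ≤ (T'.filter (· ∈ ω)).card} := by rw [hTins]; exact section_insert_threshold heT' r
      have s0 : {ω : Set ι | ω \ {e} ∈ {ω : Set ι | r + 1 ≤ (T.filter (· ∈ ω)).card}} =
          {ω : Set ι | r + 1 ≤ (T'.filter (· ∈ ω)).card} := by rw [hTins]; exact section_sdiff_threshold heT' r
      rw [s1, s0]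
      have hU1 : IsUpperSet {ω : Set ι | insert e ω ∈ U} := isUpperSet_section_insert hU e
      have hU0 : IsUpperSet {ω : Set ι | ω \ {e} ∈ U} := isUpperSet_section_sdiff hU e
      have n11 := ih T' r hcard hU1
      have n00 := ih T' (r + 1) hcard hU0
      have n10 := ih T' (r + 1) hcard hU1
      have n01 := ih T' r hcard hU0
      have hp0 : 0 ≤ (p e : ℝ) := (p e).2.1
      have hp1 : (p e : ℝ) ≤ 1 := (p e).2.2
      have hH1 : (prodBernoulli p).real {ω : Set ι | t ≤ (F.filter (· ∈ ω)).card} ≤ 1 := measureReal_le_one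
      have hlast : 0 ≤ (prodBernoulli p).real ({ω : Set ι | t ≤ (F.filter (· ∈ ω)).card} ∩
          ({ω : Set ι | insert e ω ∈ U} \ {ω : Set ι | ω \ {e} ∈ U}) ∩
          ({ω : Set ι | r ≤ (T'.filter (· ∈ ω)).card} \ {ω : Set ι | r + 1 ≤ (T'.filter (· ∈ ω)).card})) :=
        measureReal_nonneg
      have h4 : 0 ≤ (1 - (prodBernoulli p).real {ω : Set ι | t ≤ (F.filter (· ∈ ω)).card}) * ((p e : ℝ) * (1 - p e)) :=
        mul_nonneg (by linarith) (mul_nonneg hp0 (by linarith))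
      exact add_nonneg (add_nonneg (add_nonneg (mul_nonneg (sq_nonneg _) n11) (mul_nonneg (sq_nonneg _) n00))
        (mul_nonneg (mul_nonneg hp0 (by linarith)) (add_nonneg n10 n01))) (mul_nonneg h4 hlast)

/-- **KAHN C5 / SAHI `C₃` FOR TWO ARBITRARY BLOCK THRESHOLDS AND AN ARBITRARY THIRD EVENT.**  For every product measure, all finsets
`F, T`, all `t r : ℕ` and every increasing `U`:  `0 ≤ E₃(1_{N_F ≥ t}, 1_U, 1_{N_T ≥ r})`. [this work] -/
theorem sahiE3_threshold_blockThreshold_nonneg (p : ι → unitInterval) (F T : Finset ι) (t r : ℕ) {U : Set (Set ι)} (hU : IsUpperSet U) :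
    0 ≤ sahiE3 (prodBernoulli p) {ω : Set ι | t ≤ (F.filter (· ∈ ω)).card} U {ω : Set ι | r ≤ (T.filter (· ∈ ω)).card} := by
  rw [← osT_ind_ind, osT_eq_osMp_add_osN]
  exact add_nonneg (osMp_threshold_nonneg_all p F t hU (isUpperSet_threshold T r))
    (osN_threshold_blockThreshold_nonneg p F t _ T r rfl hU)

/-- Slots exchanged: `0 ≤ E₃(1_{N_F ≥ t}, 1_{N_T ≥ r}, 1_U)`. [this work] -/
theorem sahiE3_threshold_blockThreshold_nonneg' (p : ι → unitInterval) (F T : Finset ι) (t r : ℕ) {U : Set (Set ι)} (hU : IsUpperSet U) :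
    0 ≤ sahiE3 (prodBernoulli p) {ω : Set ι | t ≤ (F.filter (· ∈ ω)).card} {ω : Set ι | r ≤ (T.filter (· ∈ ω)).card} U := by
  rw [← osT_ind_ind, osT_eq_osMp_add_osN, osMp_comm, osN_comm]
  exact add_nonneg (osMp_threshold_nonneg_all p F t hU (isUpperSet_threshold T r))
    (osN_threshold_blockThreshold_nonneg p F t _ T r rfl hU)

end SahiOneStep

end Summit.CriticalPhenomena.PercolationContinuityZ3.Theorems
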